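import Literature.NumberTheory.Transcendental.GammaIsoAlgebraicStep
import Literature.NumberTheory.Transcendental.GammaKummerLevels
import HarnessLib

/-!
# One-step extensions of Γ-isomorphisms, II: logarithms of algebraic elements (Bays–Kirby §4.4)

Companion of `GammaIsoAlgebraicStep.lean` (toolkit for Bays–Kirby 2018, Prop. 11.2,
`Literature.NumberTheory.Transcendental.BaysKirby2018_prop_11_2`; M. Bays, J. Kirby, *Pseudo-exponential maps, variants, and
quasiminimality*, Algebra & Number Theory 12 (2018), arXiv:1512.04262, §4.4 Thm 4.17 and the
reduction "`A = A^full ∧ B`" in the proof of Lemma 8.3). Here the **logarithmic step**: `c ↦ c'`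
a Γ-isomorphism over a Γ-closed `K` between strong subspaces, `F` algebraically closed with `exp`
onto `Fˣ`, and `d ∉ K + ℚc` with `exp d` *algebraic* over `⟨K c⟩`. Then
(`IsGammaIso.exists_append_single_of_exp_mem_acl`) there is `d' ∉ K + ℚc'` with `exp d'`
algebraic over `⟨K c'⟩` and `(c, d) ↦ (c', d')` a Γ-isomorphism over `K`.

Proof. Unlike the algebraic step, the division points `exp (d/m)` are algebraic, so the
isomorphism type of `⟨K c d⟩` over `⟨K c⟩` is not determined by the minimal polynomial of `exp d`
alone: this is where good bases enter (Prop. 3.22, via Kummer theory, `GammaKummerLevels.lean`).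
After re-basing `(c, d)` to a normalised basis (`GammaField.exists_normalised_basis`: the
exponentials are Kummer-independent over the level-`0` field), a Γ-isomorphism is produced by a
level-`0` embedding (`GammaField.isGammaIso_of_adjoinPtFieldHom`), and the level-`0` embedding
`K₀(c, d, exp c, exp d) → F` is the point embedding (`GammaField.pointFieldHom`) attached to the
equality of level-`0` relation ideals, which holds because `exp d ↦ exp d'` transports the minimal
polynomial (`IsGammaIso.aeval_sumElim_single_eq_zero_iff`) and `d`, `d'` are transcendental over
`K₀[c, exp c, exp d]`, `K₀[c', exp c', exp d']` (`not_mem_acl_of_exp_mem_acl`, strongness). The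
choice of `d'`: any logarithm of any root of the transported minimal polynomial of `exp d`;
`d' ∉ K + ℚc'` because otherwise `exp d` would be `exp a` for some `a ∈ K + ℚc`, forcing
`d ∈ K + ℚc` (`IsGammaClosed.sub_mem_of_exp_eq`).

## Contents

* `IsGammaIso.transport_eq_transport` — Γ-isomorphisms agreeing on generators have the same
  transport map on the generated subspace.
* `IsGammaIso.append_single_of_indepModPowers` — the Γ-isomorphism `(c, d) ↦ (c', d')` for a
  Kummer-normalised `(c, d)`.
* `IsGammaIso.exists_append_single_of_exp_mem_acl_of_indepModPowers`, and the general
  `IsGammaIso.exists_append_single_of_exp_mem_acl` (for `c` linearly independent over `K`).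

## References

* M. Bays, J. Kirby, *Pseudo-exponential maps, variants, and quasiminimality*, Algebra & Number
  Theory 12 (2018) 493–549: Prop. 3.22, Lemma 4.8, §4.4 (Thm 4.17, proof), Lemma 8.3 (proof),
  Prop. 11.2.
-/

noncomputable section

open Set MvPolynomial

namespace Literature.NumberTheory.Transcendental

namespace GammaField

open Literature.ModelTheory.ExponentialFields.ExponentialRing ZilberHomogeneity
open Literature.FieldTheory.Kummer

variable {F : Type*} [Field F] [CharZero F] [Literature.ModelTheory.ExponentialFields.ExponentialRing F]
variable {K : Submodule ℚ F} {N : ℕ}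

/-! ### Transports agree on common subspaces -/

/-- **Γ-isomorphisms agreeing on generators have the same transport.** If `x ↦ x'` and `y ↦ y'`
are Γ-isomorphisms over `K`, the `xᵢ` lie in `K + ℚy` and the transport of `y ↦ y'` sends
`xᵢ ↦ x'ᵢ`, then both transports agree on `K + ℚx` (both are `ℚ`-linear and fix `K`). [folklore] -/
theorem IsGammaIso.transport_eq_transport {n m : ℕ} {x x' : Fin n → F} {y y' : Fin m → F}
    (h₁ : IsGammaIso K x x') (h₂ : IsGammaIso K y y')
    (hxy : ∀ i, x i ∈ K ⊔ Submodule.span ℚ (range y)) (heq : ∀ i, h₂.transport (x i) = x' i)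
    {z : F} (hz : z ∈ K ⊔ Submodule.span ℚ (range x)) : h₁.transport z = h₂.transport z := by
  classical
  obtain ⟨κ, hκ, w, hw, rfl⟩ := Submodule.mem_sup.1 hz
  obtain ⟨q, rfl⟩ := (Submodule.mem_span_range_iff_exists_fun ℚ).1 hw
  rw [h₁.transport_add_sum_smul hκ q]
  have hsum : (∑ i, q i • x i) ∈ K ⊔ Submodule.span ℚ (range y) :=
    Submodule.sum_mem _ fun i _ => Submodule.smul_mem _ _ (hxy i)
  rw [h₂.transport_add (Submodule.mem_sup_left hκ) hsum, h₂.transport_of_mem hκ]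
  congr 1
  induction (Finset.univ : Finset (Fin n)) using Finset.induction_on with
  | empty => simp [h₂.transport_of_mem K.zero_mem]
  | insert i s hi ih =>
    rw [Finset.sum_insert hi, Finset.sum_insert hi,
      h₂.transport_add (Submodule.smul_mem _ _ (hxy i))
        (Submodule.sum_mem _ fun j _ => Submodule.smul_mem _ _ (hxy j)),
      h₂.transport_smul _ (hxy i), heq i, ih]

/-! ### Level `0`: the appended tuple `(c, d)` -/

omit [CharZero F] in
/-- The level-`0` generators of `(c, d)`, re-indexed as `(d; exp d; c, exp c)`. [folklore] -/
theorem lvGens_zero_append_single_eq_comp (c : Fin N → F) (d : F) :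
    lvGens 0 (Fin.append c ![d]) =
      Sum.elim ![d] (Sum.elim ![exp d] (lvGens 0 c)) ∘
        (Sum.elim
          (Fin.addCases (fun i => Sum.inr (Sum.inr (Sum.inl i))) fun _ => Sum.inl 0)
          (Fin.addCases (fun i => Sum.inr (Sum.inr (Sum.inr i))) fun _ => Sum.inr (Sum.inl 0)) :
          Fin (N + 1) ⊕ Fin (N + 1) → Fin 1 ⊕ (Fin 1 ⊕ (Fin N ⊕ Fin N))) := by
  funext s
  rcases s with j | j
  · refine Fin.addCases (fun i => ?_) (fun i => ?_) j
    · simp [lvGens]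
    · simp [lvGens, Fin.fin_one_eq_zero i]
  · refine Fin.addCases (fun i => ?_) (fun i => ?_) j
    · simp [lvGens]
    · simp [lvGens, Fin.fin_one_eq_zero i]

/-- If `d ∉ acl (gens (K + ℚc) ∪ {exp d})` then `d` is algebraically independent (as a one-element
family) over `K₀[exp d, c, exp c]`. [folklore] -/
theorem algebraicIndependent_single_of_not_mem_acl {c : Fin N → F} {d : F}
    (hd : d ∉ acl (insert (exp d) (gens (K ⊔ Submodule.span ℚ (range c))))) :
    AlgebraicIndependent (Algebra.adjoin (fieldOf K) (range (Sum.elim ![exp d] (lvGens 0 c))))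
      ![d] := by
  rw [algebraicIndependent_iff_transcendental]
  exact transcendental_of_not_mem_acl _ (coe_adjoin_sumElim_single_lvGens_subset_acl 0 c (exp d)) hd

/-- **Level-`0` relation ideals of `(c, d)` and `(c', d')`** coincide when `c ↦ c'` is a
Γ-isomorphism over `K` with field isomorphism `θ`, `exp d` is integral over `⟨K c⟩` with `exp d'`
a root of `θ(minpoly (exp d))`, and `d`, `d'` are transcendental over `K₀[c, exp c, exp d]`,
`K₀[c', exp c', exp d']`. [cite: BaysKirby2018ANT, §4.4 (Thm 4.17, proof)] -/
theorem IsGammaIso.ker_aeval_lvGens_zero_append_single_eq {c c' : Fin N → F} (h : IsGammaIso K c c')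
    {d d' : F} (hyi : IsIntegral (IntermediateField.adjoin (fieldOf K) (allGens c)) (exp d))
    (hY : Polynomial.eval₂ ((algebraMap (IntermediateField.adjoin (fieldOf K) (allGens c')) F).comp
      h.fieldEquiv.toRingHom) (exp d')
        (minpoly (IntermediateField.adjoin (fieldOf K) (allGens c)) (exp d)) = 0)
    (hd : d ∉ acl (insert (exp d) (gens (K ⊔ Submodule.span ℚ (range c)))))
    (hd' : d' ∉ acl (insert (exp d') (gens (K ⊔ Submodule.span ℚ (range c'))))) :
    RingHom.ker (aeval (lvGens 0 (Fin.append c ![d])) :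
        MvPolynomial (Fin (N + 1) ⊕ Fin (N + 1)) (fieldOf K) →ₐ[fieldOf K] F) =
      RingHom.ker (aeval (lvGens 0 (Fin.append c' ![d'])) :
        MvPolynomial (Fin (N + 1) ⊕ Fin (N + 1)) (fieldOf K) →ₐ[fieldOf K] F) := by
  have hv : RingHom.ker (aeval (Sum.elim ![exp d] (lvGens 0 c)) :
      MvPolynomial (Fin 1 ⊕ (Fin N ⊕ Fin N)) (fieldOf K) →ₐ[fieldOf K] F) =
      RingHom.ker (aeval (Sum.elim ![exp d'] (lvGens 0 c')) :
      MvPolynomial (Fin 1 ⊕ (Fin N ⊕ Fin N)) (fieldOf K) →ₐ[fieldOf K] F) := by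
    ext P
    rw [RingHom.mem_ker, RingHom.mem_ker]
    exact h.aeval_sumElim_single_eq_zero_iff hyi hY 0 P
  have key := ker_aeval_sumElim_eq hv (algebraicIndependent_single_of_not_mem_acl hd)
    (algebraicIndependent_single_of_not_mem_acl hd')
  rw [lvGens_zero_append_single_eq_comp, lvGens_zero_append_single_eq_comp]
  exact ker_aeval_comp_eq key _

/-- **The logarithmic step for a Kummer-normalised tuple.** In the situation of
`ker_aeval_lvGens_zero_append_single_eq`, if moreover `K` is Γ-closed in the algebraically closed
`F` and the exponentials of `(c, d)` are independent modulo `m`-th powers in the level-`0` field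
`K₀(c, d, exp c, exp d)` for every `m ≥ 1` (a good basis, Prop. 3.22), then `(c, d) ↦ (c', d')`
is a Γ-isomorphism over `K`: the level-`0` embedding exists by the equality of relation ideals
(`GammaField.pointFieldHom`) and extends to all levels by `GammaField.isGammaIso_of_adjoinPtFieldHom`.
[cite: BaysKirby2018ANT, Prop. 3.22, §4.4 (Thm 4.17, proof)] -/
theorem IsGammaIso.append_single_of_indepModPowers [IsAlgClosed F] (hK : IsGammaClosed K)
    {c c' : Fin N → F} (h : IsGammaIso K c c') {d d' : F}
    (hyi : IsIntegral (IntermediateField.adjoin (fieldOf K) (allGens c)) (exp d))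
    (hY : Polynomial.eval₂ ((algebraMap (IntermediateField.adjoin (fieldOf K) (allGens c')) F).comp
      h.fieldEquiv.toRingHom) (exp d')
        (minpoly (IntermediateField.adjoin (fieldOf K) (allGens c)) (exp d)) = 0)
    (hd : d ∉ acl (insert (exp d) (gens (K ⊔ Submodule.span ℚ (range c)))))
    (hd' : d' ∉ acl (insert (exp d') (gens (K ⊔ Submodule.span ℚ (range c')))))
    (hind : ∀ m, 0 < m → IndepModPowers m (expGen K (Fin.append c ![d]))) :
    IsGammaIso K (Fin.append c ![d]) (Fin.append c' ![d']) := by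
  set x := Fin.append c ![d] with hx
  set x' := Fin.append c' ![d'] with hx'
  have hker := h.ker_aeval_lvGens_zero_append_single_eq hyi hY hd hd'
  have hiff : ∀ p : MvPolynomial (Fin (N + 1) ⊕ Fin (N + 1)) (fieldOf K),
      aeval (lvGens 0 x) p = 0 ↔ eval₂ (algebraMap (fieldOf K) F) (lvGens 0 x') p = 0 := by
    intro p
    rw [← RingHom.mem_ker, hker, RingHom.mem_ker]
    rfl
  let τ : adjoinPtField K x →+* F := pointFieldHom (algebraMap (fieldOf K) F) (lvGens 0 x) (lvGens 0 x') hiff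
  refine isGammaIso_of_adjoinPtFieldHom hK τ (fun z hz => ?_) (fun i => ?_) (fun i => ?_) hind
  · have := pointFieldHom_algebraMap (algebraMap (fieldOf K) F) (lvGens 0 x) (lvGens 0 x') hiff ⟨z, hz⟩
    exact this
  · have := pointFieldHom_apply_self (algebraMap (fieldOf K) F) (lvGens 0 x) (lvGens 0 x') hiff (Sum.inl i)
    simpa only [lvGens_inl] using this
  · have := pointFieldHom_apply_self (algebraMap (fieldOf K) F) (lvGens 0 x) (lvGens 0 x') hiff (Sum.inr i)
    have e1 : expGen K x i = ⟨lvGens 0 x (Sum.inr i),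
        IntermediateField.subset_adjoin _ _ (mem_range_self (Sum.inr i))⟩ :=
      Subtype.ext (by rw [coe_expGen]; exact (lvGens_zero_inr x i).symm)
    rw [e1, this, lvGens_zero_inr]

/-! ### The logarithmic step -/

/-- **The logarithmic step for a Kummer-normalised tuple, existence.** Let `K` be Γ-closed in the
algebraically closed `F` with `exp` onto `Fˣ`, `c ↦ c'` a Γ-isomorphism over `K` with `K + ℚc ◁ F`,
`K + ℚc' ◁ F`, and `d ∉ K + ℚc` with `exp d` algebraic over `⟨K c⟩` and `(c, d)` Kummer-normalised.
Then there is `d' ∉ K + ℚc'` with `exp d'` algebraic over `⟨K c'⟩` and `(c, d) ↦ (c', d')` a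
Γ-isomorphism over `K`: `d'` is any logarithm of any root of the transport of the minimal
polynomial of `exp d`. [cite: BaysKirby2018ANT, §4.4 (Thm 4.17, proof), Lemma 8.3 (proof)] -/
theorem IsGammaIso.exists_append_single_of_exp_mem_acl_of_indepModPowers [IsAlgClosed F]
    (hK : IsGammaClosed K) (hsurj : IsSurjectiveOntoUnits F) {c c' : Fin N → F}
    (h : IsGammaIso K c c') (hs : IsStrong (K ⊔ Submodule.span ℚ (range c)))
    (hs' : IsStrong (K ⊔ Submodule.span ℚ (range c'))) {d : F}
    (hdacl : exp d ∈ acl (gens (K ⊔ Submodule.span ℚ (range c))))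
    (hdX : d ∉ K ⊔ Submodule.span ℚ (range c))
    (hind : ∀ m, 0 < m → IndepModPowers m (expGen K (Fin.append c ![d]))) :
    ∃ d' : F, exp d' ∈ acl (gens (K ⊔ Submodule.span ℚ (range c'))) ∧
      d' ∉ K ⊔ Submodule.span ℚ (range c') ∧
      IsGammaIso K (Fin.append c ![d]) (Fin.append c' ![d']) := by
  classical
  set E := IntermediateField.adjoin (fieldOf K) (allGens c) with hE
  set E' := IntermediateField.adjoin (fieldOf K) (allGens c') with hE'
  set θ : E ≃+* E' := h.fieldEquiv with hθ
  set y := exp d with hy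
  have hyi : IsIntegral E y := isIntegral_adjoinField_of_mem_acl hdacl
  set g := minpoly E y with hg
  set g' : Polynomial E' := g.map θ.toRingHom with hg'
  have hgirr : Irreducible g := minpoly.irreducible hyi
  have hg'irr : Irreducible g' := by
    have : Polynomial.mapEquiv θ g = g' := Polynomial.mapEquiv_apply θ g
    rw [← this]
    exact (MulEquiv.irreducible_iff (Polynomial.mapEquiv θ)).2 hgirr
  -- a root `Y` of `θ(g)` in `F`, and a logarithm `d'` of it
  have hdeg : (g'.map (algebraMap E' F)).degree ≠ 0 := by
    rw [Polynomial.degree_map]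
    exact (Polynomial.degree_pos_of_irreducible hg'irr).ne'
  obtain ⟨Y, hYroot⟩ := IsAlgClosed.exists_root _ hdeg
  have hY : Polynomial.eval₂ ((algebraMap E' F).comp θ.toRingHom) Y g = 0 := by
    rw [← Polynomial.eval₂_map, ← hg', ← Polynomial.eval_map]
    exact hYroot
  have hYg' : Polynomial.aeval Y g' = 0 := by
    rw [Polynomial.aeval_def, hg', Polynomial.eval₂_map]; exact hY
  have hY0 : Y ≠ 0 := by
    rintro rfl
    -- then `X ∣ g'`, so `g' = X` up to a unit, so `g = X` and `y = 0`
    have hdvd : Polynomial.X ∣ g' := by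
      rw [Polynomial.X_dvd_iff]
      have h0 : (g'.map (algebraMap E' F)).coeff 0 = 0 := by
        rw [Polynomial.coeff_zero_eq_eval_zero]; exact hYroot
      rw [Polynomial.coeff_map] at h0
      exact (algebraMap E' F).injective (by rw [h0, map_zero])
    have hg'm : g'.Monic := (minpoly.monic hyi).map _
    have hassoc : Associated Polynomial.X g' := Polynomial.irreducible_X.associated_of_dvd hg'irr hdvd
    have heq : g' = Polynomial.X :=
      (Polynomial.eq_of_monic_of_associated Polynomial.monic_X hg'm hassoc).symm
    have hgX : g = Polynomial.X := by
      apply Polynomial.map_injective θ.toRingHom θ.toRingHom.injective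
      rw [← hg', heq, Polynomial.map_X]
    have := minpoly.aeval E y
    rw [← hg, hgX, Polynomial.aeval_X] at this
    exact exp_ne_zero d this
  obtain ⟨d', hd'Y⟩ := hsurj Y hY0
  -- `exp d'` is algebraic over `⟨K c'⟩`
  have hYalg : IsAlgebraic E' Y := ⟨g', hg'irr.ne_zero, hYg'⟩
  have hd'acl : exp d' ∈ acl (gens (K ⊔ Submodule.span ℚ (range c'))) := by
    rw [hd'Y, ← acl_coe_adjoinField_eq K c']
    exact mem_acl_coe_of_isAlgebraic E' hYalg
  -- `d' ∉ K + ℚc'`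
  have hd'X : d' ∉ K ⊔ Submodule.span ℚ (range c') := by
    intro hd'X
    have hYE : Y ∈ E' := by rw [← hd'Y]; exact exp_mem_adjoinField_of_mem hd'X
    have hroot : g'.IsRoot ⟨Y, hYE⟩ := by
      have h1 : algebraMap E' F (Polynomial.aeval (⟨Y, hYE⟩ : E') g') = 0 := by
        rw [← Polynomial.aeval_algebraMap_apply F (⟨Y, hYE⟩ : E') g']; exact hYg'
      have h2 : Polynomial.aeval (⟨Y, hYE⟩ : E') g' = 0 :=
        (algebraMap E' F).injective (by rw [h1, map_zero])
      rwa [Polynomial.coe_aeval_eq_eval] at h2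
    have hdeg1 : g'.degree = 1 := Polynomial.degree_eq_one_of_irreducible_of_root hg'irr hroot
    have hdegg : g.degree = 1 := by rw [hg', Polynomial.degree_map] at hdeg1; exact hdeg1
    obtain ⟨e, he⟩ := minpoly.mem_range_of_degree_eq_one E y hdegg
    have hye : y = (e : F) := he.symm
    have hge : g = Polynomial.X - Polynomial.C e := by
      rw [hg, hye]; exact minpoly.eq_X_sub_C (B := F) e
    have hYe : Y = (θ e : F) := by
      have := hYg'
      rw [hg', hge, Polynomial.map_sub, Polynomial.map_X, Polynomial.map_C, map_sub, Polynomial.aeval_X,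
        Polynomial.aeval_C, sub_eq_zero] at this
      exact this
    -- `θ⁻¹ Y = y`, but also `θ⁻¹ (exp d') = exp (θ⁻¹ d')`
    have hsymm : h.fieldEquiv.symm ⟨Y, hYE⟩ = e := by
      apply h.fieldEquiv.injective
      rw [RingEquiv.apply_symm_apply]
      exact Subtype.ext hYe
    have hexp : (h.fieldEquiv.symm ⟨exp d', exp_mem_adjoinField_of_mem hd'X⟩ : F) =
        exp (h.symm.transport d') := by
      rw [h.coe_fieldEquiv_symm_eq]
      exact h.symm.coe_fieldEquiv_exp hd'X _
    have hYeq : (⟨Y, hYE⟩ : E') = ⟨exp d', exp_mem_adjoinField_of_mem hd'X⟩ := Subtype.ext hd'Y.symm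
    rw [hYeq] at hsymm
    rw [hsymm] at hexp
    -- so `exp d = exp a` with `a ∈ K + ℚc`, hence `d ∈ K + ℚc`
    have ha : h.symm.transport d' ∈ K ⊔ Submodule.span ℚ (range c) := h.symm.transport_mem hd'X
    have hsub : d - h.symm.transport d' ∈ K := hK.sub_mem_of_exp_eq (by rw [← hy, hye, hexp])
    have : d = (d - h.symm.transport d') + h.symm.transport d' := by abel
    rw [this] at hdX
    exact hdX (Submodule.add_mem _ (Submodule.mem_sup_left hsub) ha)
  -- the Γ-isomorphism
  refine ⟨d', hd'acl, hd'X, h.append_single_of_indepModPowers hK hyi (by rw [hd'Y]; exact hY) ?_ ?_ hind⟩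
  · exact not_mem_acl_of_exp_mem_acl hs hdacl hdX
  · exact not_mem_acl_of_exp_mem_acl hs' hd'acl hd'X

omit [Literature.ModelTheory.ExponentialFields.ExponentialRing F] in
/-- Membership of the entries of `Fin.append c ![d]` in `K + ℚ(c, d)`. [folklore] -/
theorem append_single_mem_sup_span (c : Fin N → F) (d : F) (j : Fin (N + 1)) :
    Fin.append c ![d] j ∈ K ⊔ Submodule.span ℚ (range (Fin.append c ![d])) :=
  Submodule.mem_sup_right (Submodule.subset_span ⟨j, rfl⟩)

omit [Literature.ModelTheory.ExponentialFields.ExponentialRing F] in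
/-- `K + ℚ(c, d) = (K + ℚc) + ℚd`. [folklore] -/
theorem sup_span_range_append_single (K : Submodule ℚ F) (c : Fin N → F) (d : F) :
    K ⊔ Submodule.span ℚ (range (Fin.append c ![d])) =
      (K ⊔ Submodule.span ℚ (range c)) ⊔ Submodule.span ℚ {d} := by
  rw [range_append, range_single, Submodule.span_union, sup_assoc]

/-- **The logarithmic step** (Bays–Kirby 2018, §4.4, proof of Thm 4.17, together with the
existence of good bases, Prop. 3.22; used in the proof of Lemma 8.3 / Prop. 11.2 through "we may
assume `A = A^full ∧ B`"). Let `K` be Γ-closed in the algebraically closed `F` with `exp` onto `Fˣ`,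
`c ↦ c'` a Γ-isomorphism over `K` with `c` linearly independent over `K`, `K + ℚc ◁ F` and
`K + ℚc' ◁ F`, and `d ∉ K + ℚc` with `exp d` algebraic over the Γ-field `⟨K c⟩`. Then there is
`d' ∉ K + ℚc'` with `exp d'` algebraic over `⟨K c'⟩` such that `(c, d) ↦ (c', d')` is a
Γ-isomorphism over `K`. (Re-base `(c, d)` to a Kummer-normalised basis `(c̃, d₁)` of the same
subspace, apply `exists_append_single_of_exp_mem_acl_of_indepModPowers`, and transfer back.)
[cite: BaysKirby2018ANT, §4.4 (Thm 4.17, proof), Prop. 3.22, Lemma 8.3 (proof)] -/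
theorem IsGammaIso.exists_append_single_of_exp_mem_acl [IsAlgClosed F]
    (hK : IsGammaClosed K) (hsurj : IsSurjectiveOntoUnits F) {c c' : Fin N → F}
    (h : IsGammaIso K c c') (hc : LinIndepOver K c) (hs : IsStrong (K ⊔ Submodule.span ℚ (range c)))
    (hs' : IsStrong (K ⊔ Submodule.span ℚ (range c'))) {d : F}
    (hdacl : exp d ∈ acl (gens (K ⊔ Submodule.span ℚ (range c))))
    (hdX : d ∉ K ⊔ Submodule.span ℚ (range c)) :
    ∃ d' : F, exp d' ∈ acl (gens (K ⊔ Submodule.span ℚ (range c'))) ∧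
      d' ∉ K ⊔ Submodule.span ℚ (range c') ∧
      IsGammaIso K (Fin.append c ![d]) (Fin.append c' ![d']) := by
  classical
  -- normalise `(c, d)`
  have hind : LinIndepOver K (Fin.append c ![d]) := hc.append_single hdX
  obtain ⟨ct, et, hct, hcint, het, hint, -, hindep⟩ := exists_normalised_basis hK c ![d] hind
  set d₁ := et 0 with hd₁
  have het1 : et = ![d₁] := by
    funext i; rw [Fin.fin_one_eq_zero i]; rfl
  rw [het1] at het hint hindep
  -- `K + ℚct = K + ℚc`
  have hct_mem : ∀ i, ct i ∈ K ⊔ Submodule.span ℚ (range c) := fun i => Submodule.mem_sup_right (hct i)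
  have hXt : K ⊔ Submodule.span ℚ (range ct) = K ⊔ Submodule.span ℚ (range c) := by
    apply le_antisymm
    · exact sup_le le_sup_left (Submodule.span_le.2 (by rintro _ ⟨i, rfl⟩; exact hct_mem i))
    · refine sup_le le_sup_left (Submodule.span_le.2 ?_)
      rintro _ ⟨i, rfl⟩
      obtain ⟨z, hz⟩ := hcint i
      rw [SetLike.mem_coe, hz]
      exact Submodule.sum_mem _ fun l _ =>
        Submodule.smul_mem _ _ (Submodule.mem_sup_right (Submodule.subset_span ⟨l, rfl⟩))
  have hcX : ∀ i, c i ∈ K ⊔ Submodule.span ℚ (range ct) := fun i => by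
    rw [hXt]; exact Submodule.mem_sup_right (Submodule.subset_span ⟨i, rfl⟩)
  -- `K + ℚ(ct, d₁) = K + ℚ(c, d)`
  have hBt : K ⊔ Submodule.span ℚ (range (Fin.append ct ![d₁])) =
      K ⊔ Submodule.span ℚ (range (Fin.append c ![d])) := by
    apply le_antisymm
    · refine sup_le le_sup_left (Submodule.span_le.2 ?_)
      rintro _ ⟨r, rfl⟩
      refine Fin.addCases (fun i => ?_) (fun j => ?_) r
      · rw [SetLike.mem_coe, Fin.append_left, sup_span_range_append_single]
        exact Submodule.mem_sup_left (hct_mem i)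
      · rw [SetLike.mem_coe, Fin.append_right]
        exact Submodule.mem_sup_right (het j)
    · refine sup_le le_sup_left (Submodule.span_le.2 ?_)
      rintro _ ⟨s, rfl⟩
      obtain ⟨z, hz⟩ := hint s
      rw [SetLike.mem_coe, hz]
      exact Submodule.sum_mem _ fun r _ =>
        Submodule.smul_mem _ _ (Submodule.mem_sup_right (Submodule.subset_span ⟨r, rfl⟩))
  -- the Γ-isomorphism `ct ↦ ct'`
  have ht : IsGammaIso K ct (fun i => h.transport (ct i)) := h.transfer hct_mem
  have hX't : K ⊔ Submodule.span ℚ (range fun i => h.transport (ct i)) =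
      K ⊔ Submodule.span ℚ (range c') := h.sup_span_transport_eq hct_mem hcX
  have hst : IsStrong (K ⊔ Submodule.span ℚ (range ct)) := by rw [hXt]; exact hs
  have hst' : IsStrong (K ⊔ Submodule.span ℚ (range fun i => h.transport (ct i))) := by
    rw [hX't]; exact hs'
  -- `d₁ ∉ K + ℚct` and `exp d₁` is algebraic
  have hdB : d ∈ K ⊔ Submodule.span ℚ (range (Fin.append ct ![d₁])) := by
    rw [hBt]
    have := append_single_mem_sup_span (K := K) c d (Fin.natAdd N 0)
    simpa [Fin.append_right] using this
  have hd₁X : d₁ ∉ K ⊔ Submodule.span ℚ (range ct) := by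
    intro hd₁X
    have hBle : K ⊔ Submodule.span ℚ (range (Fin.append ct ![d₁])) ≤ K ⊔ Submodule.span ℚ (range ct) := by
      rw [sup_span_range_append_single]
      exact sup_le le_rfl ((Submodule.span_singleton_le_iff_mem _ _).2 hd₁X)
    rw [hXt] at hBle
    exact hdX (hBle hdB)
  have hd₁acl : exp d₁ ∈ acl (gens (K ⊔ Submodule.span ℚ (range ct))) := by
    rw [hXt]
    obtain ⟨q, hq⟩ := (Submodule.mem_span_range_iff_exists_fun ℚ).1 (het 0)
    have hsplit : d₁ = (∑ i : Fin N, q (Fin.castAdd 1 i) • c i) + q (Fin.natAdd N 0) • d := by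
      have h0 : (![d₁] : Fin 1 → F) 0 = d₁ := rfl
      rw [← h0, ← hq, Fin.sum_univ_add]
      simp [Fin.append_left, Fin.append_right]
    rw [hsplit, exp_add]
    refine mul_mem_acl ?_ (exp_smul_mem_acl _ hdacl)
    refine subset_acl _ (exp_mem_gens (Submodule.mem_sup_right ?_))
    exact Submodule.sum_mem _ fun i _ => Submodule.smul_mem _ _ (Submodule.subset_span ⟨i, rfl⟩)
  -- the logarithmic step for the normalised tuple
  obtain ⟨D₁, hD₁acl, hD₁X, h₁⟩ :=
    ht.exists_append_single_of_exp_mem_acl_of_indepModPowers hK hsurj hst hst' hd₁acl hd₁X hindep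
  -- transfer back to `(c, d)`
  have hy : ∀ j, Fin.append c ![d] j ∈ K ⊔ Submodule.span ℚ (range (Fin.append ct ![d₁])) := by
    intro j; rw [hBt]; exact append_single_mem_sup_span c d j
  have h₂ := h₁.transfer hy
  -- the transport of `h₁` agrees with that of `h` on `K + ℚc`
  have hct_memB : ∀ i, ct i ∈ K ⊔ Submodule.span ℚ (range (Fin.append ct ![d₁])) := fun i => by
    have := append_single_mem_sup_span (K := K) ct d₁ (Fin.castAdd 1 i)
    rwa [Fin.append_left] at this
  have hagree : ∀ z ∈ K ⊔ Submodule.span ℚ (range c), h₁.transport z = h.transport z := by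
    intro z hz
    rw [← hXt] at hz
    have e1 : ht.transport z = h₁.transport z :=
      ht.transport_eq_transport h₁ hct_memB (fun i => by
        have := h₁.transport_apply (Fin.castAdd 1 i)
        rwa [Fin.append_left, Fin.append_left] at this) hz
    have e2 : ht.transport z = h.transport z :=
      ht.transport_eq_transport h hct_mem (fun _ => rfl) hz
    rw [← e1, e2]
  have hfun : (fun j => h₁.transport (Fin.append c ![d] j)) = Fin.append c' ![h₁.transport d] := by
    funext j
    refine Fin.addCases (fun i => ?_) (fun i => ?_) j
    · rw [Fin.append_left, Fin.append_left,
        hagree _ (Submodule.mem_sup_right (Submodule.subset_span ⟨i, rfl⟩)), h.transport_apply]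
    · rw [Fin.append_right, Fin.append_right, Fin.fin_one_eq_zero i]; rfl
  rw [hfun] at h₂
  refine ⟨h₁.transport d, ?_, ?_, h₂⟩
  · -- `exp d'` is algebraic over `⟨K c'⟩`
    have hd'mem : h₁.transport d ∈ K ⊔ Submodule.span ℚ (range (Fin.append (fun i => h.transport (ct i)) ![D₁])) :=
      h₁.transport_mem hdB
    rw [sup_span_range_append_single, hX't] at hd'mem
    obtain ⟨x₀, hx₀, w, hw, hsum⟩ := Submodule.mem_sup.1 hd'mem
    obtain ⟨q, rfl⟩ := Submodule.mem_span_singleton.1 hw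
    rw [← hsum, exp_add]
    rw [hX't] at hD₁acl
    exact mul_mem_acl (subset_acl _ (exp_mem_gens hx₀)) (exp_smul_mem_acl q hD₁acl)
  · -- `d' ∉ K + ℚc'`
    intro hd'X
    have hback : h₁.symm.transport (h₁.transport d) = d := h₁.transport_symm_transport hdB
    -- the transport of `h₁.symm` agrees with that of `h.symm` on `K + ℚc'`
    have hct'_memB : ∀ i, h.transport (ct i) ∈
        K ⊔ Submodule.span ℚ (range (Fin.append (fun i => h.transport (ct i)) ![D₁])) := fun i => by
      have := append_single_mem_sup_span (K := K) (fun i => h.transport (ct i)) D₁ (Fin.castAdd 1 i)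
      rwa [Fin.append_left] at this
    have hct'_mem : ∀ i, h.transport (ct i) ∈ K ⊔ Submodule.span ℚ (range c') := fun i =>
      h.transport_mem (hct_mem i)
    have hz : h₁.transport d ∈ K ⊔ Submodule.span ℚ (range fun i => h.transport (ct i)) := by
      rw [hX't]; exact hd'X
    have e1 : ht.symm.transport (h₁.transport d) = h₁.symm.transport (h₁.transport d) :=
      ht.symm.transport_eq_transport h₁.symm hct'_memB (fun i => by
        have := h₁.symm.transport_apply (Fin.castAdd 1 i)
        rwa [Fin.append_left, Fin.append_left] at this) hz
    have e2 : ht.symm.transport (h₁.transport d) = h.symm.transport (h₁.transport d) :=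
      ht.symm.transport_eq_transport h.symm hct'_mem
        (fun i => h.transport_symm_transport (hct_mem i)) hz
    have hmem : h.symm.transport (h₁.transport d) ∈ K ⊔ Submodule.span ℚ (range c) :=
      h.symm.transport_mem hd'X
    rw [← e2, e1, hback] at hmem
    exact hdX hmem

end GammaField

end Literature.NumberTheory.Transcendental
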